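/-
COR-CM (cell pub-hodgecm2, stage 2 of the Hodge ladder) — count-neutral KERNEL COMBINATORICS «the sheared dihedral family», part VII: the SLICE DATUM
(gen 44ʼs quartic-inversion datum with `t² = 1`) and its dictionary `CMF G c ≃ Ty₄ B` (seat prover-pub-hodgecm2-b23-g52-0, binder prover b23, gen 52;
claim «SYLOW TRANSFER XII + THE SHEARED DIHEDRAL FAMILY», HOME/INBOX.md l.23708).  PORT of gen 44ʼs `Census/QuarticInversionDictionary.lean` (this
lineage) with ONE field changed (`t_mul_t : t * t = 1`); bookkeeping definitions with bodies (`SliceDatum`, `ty`, `typeSetOf`, `typeOf`, `typeEquiv`) +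
theorems, on the intrinsic currency (`CMF`, `rt`) and gen 44ʼs label model (`Ty₄`) BY NAME; no `decide` beyond closed identities in `ZMod 2`, no
certificate, no named fact, no `sorry`.  `Interfaces.lean` (C1), every E term, B01, `Transposition/*`, `PortJoin/*`, `D2Bridge/*` untouched.
HONEST FRAMING: `HC_CM` is NOT proved, here or anywhere in the tree; nothing here is a period, a count of record or a headline.
-/
import Summits.HodgeConjecture.CorCM.Census.BlockParityLaw
import Summits.HodgeConjecture.CorCM.Census.ShearedDihedralModel
/-!
# The sheared dihedral family, VII: the slice datum (`t² = 1`) and the dictionary `CMF G c ≃ Ty₄ B`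

A SLICE DATUM of square class `ζ ∈ ℤ/2` on `(G, c)` over the additive group `B` (`SliceDatum G c B ζ`) is an embedded copy `ι : ℤ/2 × B ↪ G`
(`ι (a + b) = ι a · ι b`, `ι (1,0) = c`) and two elements `y, t ∈ G` with
  `y · ι a = ι(−a) · y`,  `y² = ι(ζ, 0)`,  `t · ι a = ι a · t`,  **`t² = 1`**,  `y · t = c · t · y`,
the four cosets `ι(H₀) ⊔ y·ι(H₀) ⊔ t·ι(H₀) ⊔ t·y·ι(H₀)` (`H₀ = ℤ/2 × B`) exhausting `G`.  This is gen 44ʼs `QuarticInversion.Datum` with the single change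
`t² = 1` in place of `t² = c`: for `ζ = 0` and `B = ℤ/n` (`n` odd) it is the sheared dihedral group `X_n = G_n` of part I (`ι(ε,a) = c^ε g^{2a}`, `y = x`,
`t = s`; bridge: part IX) — `ℤ/n ⋊ D₄` with KLEIN kernel, the fourth member of the quartet `ℤ/n ⋊ (nonabelian order 8)`.  Along such a datum the
abstract CM types `CMF G c` are gen 44ʼs quadruples of labels (§2, **`typeEquiv : CMF G c ≃ Ty₄ B`**, gen 44ʼs §2 VERBATIM over the new structure; §1
differs only in `t_mul_y_mul_t : t y t = c y`); part VIII shows that base change along `t` is part Vʼs motion `twS`.  All [folklore] [Pohlmann1968, Thm 1].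

## References
* [Pohlmann1968] H. Pohlmann, Algebraic cycles on abelian varieties of complex multiplication type, Ann. of Math. 88 (1968), Thm 1.
-/
namespace Summit.HodgeConjecture.CorCM.Census.ShearedDihedral
open Summit.HodgeConjecture.CorCM.Census.QuarticInversion (Ty₄ cst)

open Finset
open Summit.HodgeConjecture.CorCM.Prior.AllgGroup.RfwfAllgGroup
open Summit.HodgeConjecture.CorCM.Census.BlockParity
open Summit.HodgeConjecture.CorCM.Census.OddSliceFacesModel
open Summit.HodgeConjecture.CorCM.Census.DicyclicTwist (Ty₂ rev twH)

noncomputable section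
/-- **A slice datum of square class `ζ` on `(G, c)` over `B`**: an embedded `ι : ℤ/2 × B ↪ G` with `ι (1,0) = c`, `y` inverting it with `y² = ι(ζ, 0)`,
an INVOLUTION `t` centralising it with `y t = c t y`, the four cosets `ι H₀, y ι H₀, t ι H₀, t y ι H₀` exhausting `G` (`ζ = 0`, `B = ℤ/n`: `X_n`). [folklore] -/
structure SliceDatum (G : Type*) [Group G] (c : G) (A : Type) [AddCommGroup A] (ζ : ZMod 2) where
  /-- the embedding of `ℤ/2 × B` -/
  ι : ZMod 2 × A → G
  /-- the inverting element -/
  y : G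
  /-- the centralising involution -/
  t : G
  /-- `ι` is additive-to-multiplicative -/
  map_add : ∀ a b, ι (a + b) = ι a * ι b
  /-- `ι (1,0) = c` -/
  map_c : ι (1, 0) = c
  /-- `y` inverts `ι` by conjugation -/
  y_mul : ∀ a, y * ι a = ι (-a) * y
  /-- `y² = ι (ζ, 0)` -/
  y_mul_y : y * y = ι (ζ, 0)
  /-- `t` centralises `ι` -/
  t_mul : ∀ a, t * ι a = ι a * t
  /-- `t² = 1` -/
  t_mul_t : t * t = 1
  /-- `y t = c t y` (`t` conjugates `y` to `c y`) -/
  y_mul_t : y * t = c * t * y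
  /-- `ι` is injective -/
  inj : Function.Injective ι
  /-- `y ∉ ι H₀` -/
  y_ne : ∀ a, y ≠ ι a
  /-- `t ∉ ι H₀` -/
  t_ne : ∀ a, t ≠ ι a
  /-- `t ∉ y ι H₀` -/
  t_ne' : ∀ a, t ≠ y * ι a
  /-- the four cosets exhaust `G` -/
  exhaust : ∀ g : G, ∃ a, g = ι a ∨ g = y * ι a ∨ g = t * ι a ∨ g = t * (y * ι a)

/-! ## §1 First consequences of the datum -/

section Basic

variable {G : Type*} [Group G] {c : G} {A : Type} [AddCommGroup A] {ζ : ZMod 2} (D : SliceDatum G c A ζ)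

/-- `ι 0 = 1`. [folklore] -/
theorem ι_zero : D.ι 0 = 1 := by
  have h := D.map_add 0 0
  rw [add_zero] at h
  exact mul_left_cancel (a := D.ι 0) (by rw [← h, mul_one])

/-- `ι (−a) = (ι a)⁻¹`. [folklore] -/
theorem ι_neg (a : ZMod 2 × A) : D.ι (-a) = (D.ι a)⁻¹ :=
  eq_inv_of_mul_eq_one_left (by rw [← D.map_add, neg_add_cancel, ι_zero])

/-- `ι` is commutative. [folklore] -/
theorem ι_comm (a b : ZMod 2 × A) : D.ι a * D.ι b = D.ι b * D.ι a := by
  rw [← D.map_add, ← D.map_add, add_comm]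

/-- `c · ι a = ι ((1,0) + a)`. [folklore] -/
theorem c_mul_ι (a : ZMod 2 × A) : c * D.ι a = D.ι ((1, 0) + a) := by
  rw [D.map_add, D.map_c]

/-- `c · ι (e, s) = ι (e + 1, s)`. [folklore] -/
theorem c_mul_ι_mk (e : ZMod 2) (s : A) : c * D.ι (e, s) = D.ι (e + 1, s) := by
  rw [c_mul_ι, Prod.mk_add_mk, zero_add, add_comm]

/-- `−(1, 0) = (1, 0)` in `ℤ/2 × B`. [folklore] -/
theorem neg_one_zero : -((1 : ZMod 2), (0 : A)) = (1, 0) := by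
  have key : -(1 : ZMod 2) = 1 := by decide
  ext <;> simp [key]

include D in
/-- `c² = 1`. [folklore] -/
theorem c_mul_c : c * c = 1 := by
  have h : c * D.ι (1, 0) = D.ι ((1, 0) + (1, 0)) := c_mul_ι D (1, 0)
  have h11 : ((1 : ZMod 2), (0 : A)) + (1, 0) = 0 := by
    have key : (1 : ZMod 2) + 1 = 0 := by decide
    ext <;> simp [key]
  rw [D.map_c, h11, ι_zero] at h
  exact h

include D in
/-- `c ≠ 1`. [folklore] -/
theorem c_ne_one : c ≠ 1 := fun h => by
  have h1 : D.ι (1, 0) = D.ι 0 := D.map_c.trans (h.trans (ι_zero D).symm)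
  have h3 : (1 : ZMod 2) = 0 := congrArg Prod.fst (D.inj h1)
  exact absurd h3 (by decide)

/-- `ι a` commutes with `c`. [folklore] -/
theorem ι_mul_c (a : ZMod 2 × A) : D.ι a * c = c * D.ι a := by
  have h : D.ι a * D.ι (1, 0) = D.ι (1, 0) * D.ι a := ι_comm D a (1, 0)
  rwa [D.map_c] at h

/-- `y` commutes with `c`. [folklore] -/
theorem y_mul_c : D.y * c = c * D.y := by
  have h := D.y_mul (1, 0)
  rwa [neg_one_zero, D.map_c] at h

/-- `t` commutes with `c`. [folklore] -/
theorem t_mul_c : D.t * c = c * D.t := by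
  have h := D.t_mul (1, 0)
  rwa [D.map_c] at h

include D in
/-- **`c` is central.** [folklore] -/
theorem mul_c_comm (g : G) : g * c = c * g := by
  obtain ⟨a, rfl | rfl | rfl | rfl⟩ := D.exhaust g
  · exact ι_mul_c D a
  · rw [mul_assoc, ι_mul_c, ← mul_assoc, y_mul_c, mul_assoc]
  · rw [mul_assoc, ι_mul_c, ← mul_assoc, t_mul_c, mul_assoc]
  · rw [mul_assoc, mul_assoc, ι_mul_c, ← mul_assoc D.y, y_mul_c, mul_assoc, ← mul_assoc, t_mul_c, mul_assoc]

/-- `ι a · y = y · ι (−a)`. [folklore] -/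
theorem ι_mul_y (a : ZMod 2 × A) : D.ι a * D.y = D.y * D.ι (-a) := by rw [D.y_mul, neg_neg]

/-- `ι a · t = t · ι a`. [folklore] -/
theorem ι_mul_t (a : ZMod 2 × A) : D.ι a * D.t = D.t * D.ι a := (D.t_mul a).symm
/-- `t y t = c y` (`t² = 1`; for gen 44ʼs `t² = c` it was `t y t = y`). [folklore] -/
theorem t_mul_y_mul_t : D.t * D.y * D.t = c * D.y := by
  rw [mul_assoc, D.y_mul_t, ← mul_assoc, ← mul_assoc, t_mul_c, mul_assoc c, D.t_mul_t, mul_one]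

/-- `t y = c y t`. [folklore] -/
theorem t_mul_y : D.t * D.y = c * D.y * D.t := by
  rw [← t_mul_y_mul_t, mul_assoc, mul_assoc, D.t_mul_t, mul_one]

/-- `t⁻¹ = t`. [folklore] -/
theorem t_inv : D.t⁻¹ = D.t := inv_eq_of_mul_eq_one_right D.t_mul_t

/-- `y⁻¹ = y · ι(−(ζ, 0))`. [folklore] -/
theorem y_inv : D.y⁻¹ = D.y * D.ι (-(ζ, 0)) := by
  rw [ι_neg, ← D.y_mul_y, mul_inv_rev, ← mul_assoc, mul_inv_cancel, one_mul]

/-- Conjugation by `y` inverts: `y · ι d · y⁻¹ = ι (−d)`. [folklore] -/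
theorem y_conj (d : ZMod 2 × A) : D.y * D.ι d * D.y⁻¹ = D.ι (-d) := by
  rw [D.y_mul, mul_inv_cancel_right]

/-- `ι(0,s) · ι a = ι (a.1, s + a.2)`. [folklore] -/
theorem ι0_mul_ι (s : A) (a : ZMod 2 × A) : D.ι (0, s) * D.ι a = D.ι (a.1, s + a.2) := by
  rw [← D.map_add, Prod.mk_add_mk, zero_add]

/-- `c · y ι(e,s) = y ι(e+1, s)`. [folklore] -/
theorem c_mul_yι (e : ZMod 2) (s : A) : c * (D.y * D.ι (e, s)) = D.y * D.ι (e + 1, s) := by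
  rw [← mul_assoc, ← y_mul_c, mul_assoc, c_mul_ι_mk]

/-- `c · t ι(e,s) = t ι(e+1, s)`. [folklore] -/
theorem c_mul_tι (e : ZMod 2) (s : A) : c * (D.t * D.ι (e, s)) = D.t * D.ι (e + 1, s) := by
  rw [← mul_assoc, ← t_mul_c, mul_assoc, c_mul_ι_mk]

/-- `c · t y ι(e,s) = t y ι(e+1, s)`. [folklore] -/
theorem c_mul_tyι (e : ZMod 2) (s : A) : c * (D.t * (D.y * D.ι (e, s))) = D.t * (D.y * D.ι (e + 1, s)) := by
  rw [← mul_assoc c D.t, ← t_mul_c, mul_assoc, c_mul_yι]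

/-- Solving `ι a = g · ι b` for `g`. [folklore] -/
theorem eq_ι_sub_of (g : G) (a b : ZMod 2 × A) (h : D.ι a = g * D.ι b) : g = D.ι (a - b) := by
  rw [sub_eq_add_neg, D.map_add, h, mul_assoc, ← D.map_add, add_neg_cancel, ι_zero, mul_one]

/-- The cosets `ι H₀` and `y ι H₀` are disjoint. [folklore] -/
theorem ι_ne_yι (a b : ZMod 2 × A) : D.ι a ≠ D.y * D.ι b := fun h => D.y_ne _ (eq_ι_sub_of D _ _ _ h)

/-- The cosets `ι H₀` and `t ι H₀` are disjoint. [folklore] -/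
theorem ι_ne_tι (a b : ZMod 2 × A) : D.ι a ≠ D.t * D.ι b := fun h => D.t_ne _ (eq_ι_sub_of D _ _ _ h)

/-- The cosets `y ι H₀` and `t ι H₀` are disjoint. [folklore] -/
theorem yι_ne_tι (a b : ZMod 2 × A) : D.y * D.ι a ≠ D.t * D.ι b := fun h => by
  have h' : D.ι a = D.y⁻¹ * D.t * D.ι b := by rw [mul_assoc, ← h, inv_mul_cancel_left]
  have h2 := eq_ι_sub_of D _ _ _ h'
  exact D.t_ne' (a - b) (by rw [← h2, mul_inv_cancel_left])

/-- The cosets `ι H₀` and `t y ι H₀` are disjoint. [folklore] -/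
theorem ι_ne_tyι (a b : ZMod 2 × A) : D.ι a ≠ D.t * (D.y * D.ι b) := fun h => by
  rw [← mul_assoc] at h
  have h2 := eq_ι_sub_of D _ _ _ h
  -- t = ι(a-b) y⁻¹ = ι(a-b) y ι(−(ζ,0)) = y ι(−(a−b)) ι(−(ζ,0))
  apply D.t_ne' (-(a - b) + -(ζ, 0))
  have h3 : D.t = D.ι (a - b) * D.y⁻¹ := by rw [← h2, mul_inv_cancel_right]
  rw [h3, y_inv, ← mul_assoc, ι_mul_y, mul_assoc, ← D.map_add]

/-- The cosets `y ι H₀` and `t y ι H₀` are disjoint. [folklore] -/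
theorem yι_ne_tyι (a b : ZMod 2 × A) : D.y * D.ι a ≠ D.t * (D.y * D.ι b) := fun h => by
  have h' : D.ι a = D.y⁻¹ * D.t * D.y * D.ι b := by
    rw [mul_assoc, mul_assoc, ← h, inv_mul_cancel_left]
  have h2 := eq_ι_sub_of D _ _ _ h'
  -- y⁻¹ t y = ι(a-b) ⇒ t = y ι(a-b) y⁻¹ = ι(−(a−b))
  apply D.t_ne (-(a - b))
  rw [← y_conj, ← h2, ← mul_assoc, ← mul_assoc, mul_inv_cancel, one_mul, mul_inv_cancel_right]

/-- The cosets `t ι H₀` and `t y ι H₀` are disjoint. [folklore] -/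
theorem tι_ne_tyι (a b : ZMod 2 × A) : D.t * D.ι a ≠ D.t * (D.y * D.ι b) := fun h =>
  ι_ne_yι D a b (mul_left_cancel h)

/-- `y·ι` is injective. [folklore] -/
theorem yι_injective : Function.Injective fun a => D.y * D.ι a := fun _ _ h => D.inj (mul_left_cancel h)
/-- `t·ι` is injective. [folklore] -/
theorem tι_injective : Function.Injective fun a => D.t * D.ι a := fun _ _ h => D.inj (mul_left_cancel h)
/-- `t·y·ι` is injective. [folklore] -/
theorem tyι_injective : Function.Injective fun a => D.t * (D.y * D.ι a) := fun _ _ h => D.inj (mul_left_cancel (mul_left_cancel h))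

end Basic

/-! ## §2 Labels of abstract CM types and the dictionary -/

section Dict

variable {G : Type*} [Group G] [Fintype G] [DecidableEq G] {c : G} {A : Type} [AddCommGroup A] [Fintype A] {ζ : ZMod 2}
variable (D : SliceDatum G c A ζ)


/-- **The quadruple of labels** of an abstract CM type (`1` marks NON-membership of `ι(0,s)`, `y ι(0,s)`, `t ι(0,s)`, `t y ι(0,s)`). [folklore] -/
def ty (Ψ : CMF G c) : Ty₄ A :=
  ((fun s => if D.ι (0, s) ∈ Ψ.1 then 0 else 1, fun s => if D.y * D.ι (0, s) ∈ Ψ.1 then 0 else 1),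
   (fun s => if D.t * D.ι (0, s) ∈ Ψ.1 then 0 else 1, fun s => if D.t * (D.y * D.ι (0, s)) ∈ Ψ.1 then 0 else 1))

/-- `ℤ/2` has two elements. [folklore] -/
private theorem zmod2_cases : ∀ e : ZMod 2, e = 0 ∨ e = 1 := by decide

/-- Two elements of `ℤ/2` that vanish together are equal. [folklore] -/
private theorem zmod2_eq_of_iff : ∀ {u v : ZMod 2}, (u = 0 ↔ v = 0) → u = v := by decide

/-- `u = e ↔ u + e = 0` in `ℤ/2`. [folklore] -/
private theorem eq_iff_add_eq_zero : ∀ u e : ZMod 2, u = e ↔ u + e = 0 := by decide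

omit [Fintype A] in
/-- Membership of `g·ι(e,s)` from membership of `g·ι(0,s)`, for `g` commuting with `c`. [folklore] -/
private theorem mem_iff_of_prefix (Ψ : CMF G c) {g : G} (hg : g * c = c * g) (e : ZMod 2) (s : A) :
    (g * D.ι (e, s) ∈ Ψ.1 ↔ (if g * D.ι (0, s) ∈ Ψ.1 then (0 : ZMod 2) else 1) = e) := by
  have hcm : g * D.ι (1, s) ∈ Ψ.1 ↔ g * D.ι (0, s) ∉ Ψ.1 := by
    have h := Ψ.2 (g * D.ι (0, s))
    rw [← mul_assoc, ← hg, mul_assoc, c_mul_ι_mk, zero_add] at h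
    tauto
  rcases zmod2_cases e with rfl | rfl
  · split_ifs with h <;> simp [h]
  · rw [hcm]; split_ifs with h <;> simp [h]

omit [Fintype A] in
/-- **`ι (e, s) ∈ Ψ ↔ ψ₀ s = e`.** [folklore] -/
theorem ι_mem_iff (Ψ : CMF G c) (e : ZMod 2) (s : A) : D.ι (e, s) ∈ Ψ.1 ↔ (ty D Ψ).1.1 s = e := by
  have h := mem_iff_of_prefix D Ψ (g := 1) (by rw [one_mul, mul_one]) e s
  simp only [one_mul] at h
  exact h

omit [Fintype A] in
/-- **`y·ι (e, s) ∈ Ψ ↔ ψ₁ s = e`.** [folklore] -/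
theorem yι_mem_iff (Ψ : CMF G c) (e : ZMod 2) (s : A) : D.y * D.ι (e, s) ∈ Ψ.1 ↔ (ty D Ψ).1.2 s = e :=
  mem_iff_of_prefix D Ψ (y_mul_c D) e s

omit [Fintype A] in
/-- **`t·ι (e, s) ∈ Ψ ↔ ψ₂ s = e`.** [folklore] -/
theorem tι_mem_iff (Ψ : CMF G c) (e : ZMod 2) (s : A) : D.t * D.ι (e, s) ∈ Ψ.1 ↔ (ty D Ψ).2.1 s = e :=
  mem_iff_of_prefix D Ψ (t_mul_c D) e s

omit [Fintype A] in
/-- **`t·y·ι (e, s) ∈ Ψ ↔ ψ₃ s = e`.** [folklore] -/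
theorem tyι_mem_iff (Ψ : CMF G c) (e : ZMod 2) (s : A) : D.t * (D.y * D.ι (e, s)) ∈ Ψ.1 ↔ (ty D Ψ).2.2 s = e := by
  have h := mem_iff_of_prefix D Ψ (g := D.t * D.y) (by rw [mul_assoc, y_mul_c, ← mul_assoc, t_mul_c, mul_assoc]) e s
  simp only [mul_assoc] at h
  exact h

/-- The underlying set of the abstract CM type of a quadruple of labels. [folklore] -/
def typeSetOf (Θ : Ty₄ A) : Finset G :=
  univ.filter fun g =>
    (∃ a : ZMod 2 × A, g = D.ι a ∧ Θ.1.1 a.2 = a.1) ∨ (∃ a : ZMod 2 × A, g = D.y * D.ι a ∧ Θ.1.2 a.2 = a.1) ∨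
    (∃ a : ZMod 2 × A, g = D.t * D.ι a ∧ Θ.2.1 a.2 = a.1) ∨ (∃ a : ZMod 2 × A, g = D.t * (D.y * D.ι a) ∧ Θ.2.2 a.2 = a.1)

/-- Membership of `ι a` in the set of a quadruple of labels. [folklore] -/
theorem ι_mem_typeSetOf (Θ : Ty₄ A) (a : ZMod 2 × A) : D.ι a ∈ typeSetOf D Θ ↔ Θ.1.1 a.2 = a.1 := by
  simp only [typeSetOf, mem_filter, mem_univ, true_and]
  constructor
  · rintro (⟨a', h, h'⟩ | ⟨a', h, -⟩ | ⟨a', h, -⟩ | ⟨a', h, -⟩)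
    · rw [D.inj h]; exact h'
    · exact absurd h (ι_ne_yι D a a')
    · exact absurd h (ι_ne_tι D a a')
    · exact absurd h (ι_ne_tyι D a a')
  · exact fun h => Or.inl ⟨a, rfl, h⟩

/-- Membership of `y·ι a` in the set of a quadruple of labels. [folklore] -/
theorem yι_mem_typeSetOf (Θ : Ty₄ A) (a : ZMod 2 × A) : D.y * D.ι a ∈ typeSetOf D Θ ↔ Θ.1.2 a.2 = a.1 := by
  simp only [typeSetOf, mem_filter, mem_univ, true_and]
  constructor
  · rintro (⟨a', h, -⟩ | ⟨a', h, h'⟩ | ⟨a', h, -⟩ | ⟨a', h, -⟩)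
    · exact absurd h.symm (ι_ne_yι D a' a)
    · rw [yι_injective D h]; exact h'
    · exact absurd h (yι_ne_tι D a a')
    · exact absurd h (yι_ne_tyι D a a')
  · exact fun h => Or.inr (Or.inl ⟨a, rfl, h⟩)

/-- Membership of `t·ι a` in the set of a quadruple of labels. [folklore] -/
theorem tι_mem_typeSetOf (Θ : Ty₄ A) (a : ZMod 2 × A) : D.t * D.ι a ∈ typeSetOf D Θ ↔ Θ.2.1 a.2 = a.1 := by
  simp only [typeSetOf, mem_filter, mem_univ, true_and]
  constructor
  · rintro (⟨a', h, -⟩ | ⟨a', h, -⟩ | ⟨a', h, h'⟩ | ⟨a', h, -⟩)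
    · exact absurd h.symm (ι_ne_tι D a' a)
    · exact absurd h.symm (yι_ne_tι D a' a)
    · rw [tι_injective D h]; exact h'
    · exact absurd h (tι_ne_tyι D a a')
  · exact fun h => Or.inr (Or.inr (Or.inl ⟨a, rfl, h⟩))

/-- Membership of `t·y·ι a` in the set of a quadruple of labels. [folklore] -/
theorem tyι_mem_typeSetOf (Θ : Ty₄ A) (a : ZMod 2 × A) : D.t * (D.y * D.ι a) ∈ typeSetOf D Θ ↔ Θ.2.2 a.2 = a.1 := by
  simp only [typeSetOf, mem_filter, mem_univ, true_and]
  constructor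
  · rintro (⟨a', h, -⟩ | ⟨a', h, -⟩ | ⟨a', h, -⟩ | ⟨a', h, h'⟩)
    · exact absurd h.symm (ι_ne_tyι D a' a)
    · exact absurd h.symm (yι_ne_tyι D a' a)
    · exact absurd h.symm (tι_ne_tyι D a' a)
    · rw [tyι_injective D h]; exact h'
  · exact fun h => Or.inr (Or.inr (Or.inr ⟨a, rfl, h⟩))

/-- The CM-type axiom in `ℤ/2`: `u = e ↔ ¬ u = e + 1`. [folklore] -/
private theorem eq_iff_not_eq_add_one : ∀ u e : ZMod 2, u = e ↔ ¬ u = e + 1 := by decide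

/-- The set of a quadruple of labels is an abstract CM type. [folklore] -/
theorem isCMF_typeSetOf (Θ : Ty₄ A) : IsCMF c (typeSetOf D Θ) := by
  intro g
  obtain ⟨⟨e, s⟩, rfl | rfl | rfl | rfl⟩ := D.exhaust g
  · rw [c_mul_ι_mk, ι_mem_typeSetOf, ι_mem_typeSetOf]
    exact eq_iff_not_eq_add_one _ _
  · rw [c_mul_yι, yι_mem_typeSetOf, yι_mem_typeSetOf]
    exact eq_iff_not_eq_add_one _ _
  · rw [c_mul_tι, tι_mem_typeSetOf, tι_mem_typeSetOf]
    exact eq_iff_not_eq_add_one _ _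
  · rw [c_mul_tyι, tyι_mem_typeSetOf, tyι_mem_typeSetOf]
    exact eq_iff_not_eq_add_one _ _

/-- **The abstract CM type of a quadruple of labels.** [folklore] -/
def typeOf (Θ : Ty₄ A) : CMF G c := ⟨typeSetOf D Θ, isCMF_typeSetOf D Θ⟩

/-- `ty ∘ typeOf = id`. [folklore] -/
theorem ty_typeOf (Θ : Ty₄ A) : ty D (typeOf D Θ) = Θ := by
  obtain ⟨⟨ψ₀, ψ₁⟩, ⟨ψ₂, ψ₃⟩⟩ := Θ
  refine Prod.ext (Prod.ext (funext fun s => zmod2_eq_of_iff ?_) (funext fun s => zmod2_eq_of_iff ?_))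
    (Prod.ext (funext fun s => zmod2_eq_of_iff ?_) (funext fun s => zmod2_eq_of_iff ?_))
  · rw [← ι_mem_iff]; exact ι_mem_typeSetOf D _ (0, s)
  · rw [← yι_mem_iff]; exact yι_mem_typeSetOf D _ (0, s)
  · rw [← tι_mem_iff]; exact tι_mem_typeSetOf D _ (0, s)
  · rw [← tyι_mem_iff]; exact tyι_mem_typeSetOf D _ (0, s)

/-- `typeOf ∘ ty = id`. [folklore] -/
theorem typeOf_ty (Ψ : CMF G c) : typeOf D (ty D Ψ) = Ψ := by
  apply Subtype.ext
  ext g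
  obtain ⟨⟨e, s⟩, rfl | rfl | rfl | rfl⟩ := D.exhaust g
  · exact (ι_mem_typeSetOf D _ (e, s)).trans (ι_mem_iff D Ψ e s).symm
  · exact (yι_mem_typeSetOf D _ (e, s)).trans (yι_mem_iff D Ψ e s).symm
  · exact (tι_mem_typeSetOf D _ (e, s)).trans (tι_mem_iff D Ψ e s).symm
  · exact (tyι_mem_typeSetOf D _ (e, s)).trans (tyι_mem_iff D Ψ e s).symm

/-- **THE DICTIONARY**: abstract CM types of `(G, c)` ≃ quadruples of labels. [folklore] -/
def typeEquiv : CMF G c ≃ Ty₄ A where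
  toFun := ty D
  invFun := typeOf D
  left_inv := typeOf_ty D
  right_inv := ty_typeOf D

/-- `typeEquiv Ψ = ty Ψ`. [folklore] -/
@[simp] theorem typeEquiv_apply (Ψ : CMF G c) : typeEquiv D Ψ = ty D Ψ := rfl

/-- `typeEquiv⁻¹ Θ = typeOf Θ`. [folklore] -/
@[simp] theorem typeEquiv_symm_apply (Θ : Ty₄ A) : (typeEquiv D).symm Θ = typeOf D Θ := rfl

/-- `ty` is injective. [folklore] -/
theorem ty_injective : Function.Injective (ty (c := c) D) := (typeEquiv D).injective

end Dict

end

end Summit.HodgeConjecture.CorCM.Census.ShearedDihedral
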